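import Summits.HubbardSuperconductivity.HubbardSuperconductivity.Theorems.CooperPairDMottWalkBindingWalkShibaTorus
import HarnessLib

/-!
# Route `JosephsonMirror` — crux `JmCusp` (stmt-HubbardSuperconductivity-2228):
# the Shiba (attraction–repulsion) dictionary for clause (ii) of the bet

Helper file (`--supports stmt-HubbardSuperconductivity-2228`) for the registered line
`Cruxes/JmCusp/Lines/cocountable_coupling_selection.lean`, whose open (ii)-side residue
`stub_summableDegeneracy` and clause (ii) of the crux itself are statements about SIMPLICITY of the
ground floor of the repulsive Hubbard torus `hubbardTorus 2 L 1 U` in the doped sector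
`(N, S^z) = (N_L, 0)`, `N_L = 2⌊(1-δ)L²/2⌋`.

Lieb's partial particle–hole transformation on the down spins composed with the bipartite gauge
(the Shiba unitary `S = orbitalPhase g · partialParticleHole D↓` of
`CooperPairDMottWalkBindingWalkShibaTransport`: `S H(t,U) Sᴴ = H(t,-U) + U N↑`,
`S : sector (N↑,N↓) = (a,b) → (a, |Λ|-b)`) transports GROUND STATES, not only ground energies:

* `shiba_mulVec_eigenvector` / `shiba_conjTranspose_mulVec_eigenvector` — eigenvectors of `H(t,U)`
  in the sector `(a,b)` go to eigenvectors of `H(t,-U)` in `(a,|Λ|-b)` with the eigenvalue shifted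
  by `-U a`, and back;
* `isGroundStateInSector_shiba` / `isGroundStateInSector_shiba_conjTranspose` — sector ground
  states go to sector ground states (the energy dictionary `minEnergyOn_szSector_shiba` fixes the
  bottom);
* `simpleFloor_shiba_iff` — hence the floor of `H(t,U)` in `(a,b)` is simple iff the floor of
  `H(t,-U)` in `(a,|Λ|-b)` is simple;
* `simpleFloor_hubbardTorus_iff_attractive` — on the even torus `(ℤ/Lℤ)²`:
  the `(2m, S^z = 0)` floor of `hubbardTorus 2 L t U` is simple iff the HALF-FILLED floor of the
  ATTRACTIVE torus `hubbardTorus 2 L t (-U)` in the MAGNETISED sector `(L², S^z = m - L²/2)` is simple;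
* `clauseII_iff_attractive_at` / `jmCusp_clauseII_iff_attractive` (registered form) — clause (ii)
  of `JmCusp` at `(U, δ)` (verbatim) is
  EQUIVALENT to eventual simplicity of the half-filled attractive floor in the sector
  `S^z = ⌊(1-δ)L²/2⌋ - L²/2 ≈ -δL²/2`.

Reading.  Lieb's Theorem 1 (attractive Hubbard model, tree `LiebThm1`) proves uniqueness of the
ground state among ALL `N`-particle states for `U < 0`, `N` even, by spin-reflection positivity of
the SQUARE coefficient matrix of the `S^z = 0` sector; the doped repulsive floor of clause (ii) is
the image of a sector with `N↑ ≠ N↓` of the attractive half-filled model (rectangular coefficient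
matrix), which is exactly where that argument does not reach — this file makes the obstruction a
kernel-checked equivalence rather than a remark, and puts the (ii)-residue of the line in the
language (attractive model at half filling, fixed magnetisation) in which reflection positivity,
Lieb's theorems and Tian's gap inequalities are stated.  It reformulates clause (ii); it proves
neither the stub nor the crux.

References: E. H. Lieb, PRL 62 (1989) 1201, Theorems 1–2 and the proof of Theorem 2 (partial
particle–hole transformation); H. Shiba, Prog. Theor. Phys. 48 (1972) 2171, §2; R. Micnas,
J. Ranninger, S. Robaszkiewicz, Rev. Mod. Phys. 62 (1990) 113, §II.B (attraction–repulsion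
transformation: doping ↔ magnetisation, pairing ↔ transverse magnetism).  All statements are
finite-dimensional algebra over tree definitions; no definition and no named fact is introduced.
-/

set_option linter.dupNamespace false

noncomputable section

namespace Summit.HubbardSuperconductivity.HubbardSuperconductivity.Theorems.JosephsonMirror

open Matrix Finset Literature.MathematicalPhysics.QuantumLattice Literature.Probability.LatticeModels
open Summit.HubbardSuperconductivity.HubbardSuperconductivity.Theorems.CooperPairDMottWalk
open scoped ComplexOrder

/-! ### Eigenvectors and sector ground states under the Shiba unitary (any finite graph) -/

section General

variable {Λ : Type*} [LinearOrder Λ] [Fintype Λ] (G : SimpleGraph Λ) [DecidableRel G.Adj]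

/-- **Eigenvector transport under `S`**: if `χ` lies in the sector `(N↑,N↓) = (a,b)` and
`H(t,U) χ = E χ`, then `H(t,-U) (Sχ) = (E - U a) (Sχ)` (`S H(t,U) Sᴴ = H(t,-U) + U N↑` and
`N↑ = a` on the image sector). [cite: Lieb1989, proof of Theorem 2] -/
theorem shiba_mulVec_eigenvector {g : Orb Λ → ℂ} (hg : ∀ i, ‖g i‖ = 1) (hg0 : ∀ x, g (orb x 0) = 1)
    (hg1 : ∀ x y, G.Adj x y → g (orb x 1) * star (g (orb y 1)) = -1) (t U : ℝ) {a b : ℕ}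
    {χ : Fock (Orb Λ)} (hχ : IsInSector a b χ) {E : ℂ} (hHχ : hamiltonian G t U *ᵥ χ = E • χ) :
    hamiltonian G t (-U) *ᵥ
        ((orbitalPhase g * partialParticleHole (spinDownOrbitals : Finset (Orb Λ))) *ᵥ χ) =
      (E - U * a) • ((orbitalPhase g * partialParticleHole (spinDownOrbitals : Finset (Orb Λ))) *ᵥ χ) := by
  set S : Matrix (Finset (Orb Λ)) (Finset (Orb Λ)) ℂ :=
    orbitalPhase g * partialParticleHole (spinDownOrbitals : Finset (Orb Λ)) with hS
  have hSS : Sᴴ * S = 1 := shiba_conjTranspose_mul_self hg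
  have hconj : S * hamiltonian G t U * Sᴴ = hamiltonian G t (-U) + (U : ℂ) • ∑ x : Λ, numberOp x 0 :=
    shiba_conj_hamiltonian G hg hg0 hg1 t U
  have hatt : hamiltonian G t (-U) = S * hamiltonian G t U * Sᴴ - (U : ℂ) • ∑ x : Λ, numberOp x 0 := by
    rw [hconj, add_sub_cancel_right]
  have hNup : (∑ x : Λ, numberOp x 0) *ᵥ (S *ᵥ χ) = (a : ℂ) • (S *ᵥ χ) :=
    Summit.HubbardSuperconductivity.TwTipContinuation.IsogapTransport.sum_numberOp_up_mulVec
      (isInSector_shiba_mulVec g hχ)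
  rw [hatt, sub_mulVec, smul_mulVec, hNup, mulVec_mulVec, Matrix.mul_assoc (S * hamiltonian G t U), hSS,
    Matrix.mul_one, ← mulVec_mulVec, hHχ, mulVec_smul, smul_smul, ← sub_smul]

/-- **Eigenvector transport under `Sᴴ`**: if `φ` lies in a sector with `N↑ = a` and
`H(t,-U) φ = E φ`, then `H(t,U) (Sᴴφ) = (E + U a) (Sᴴφ)`. [cite: Lieb1989, proof of Theorem 2] -/
theorem shiba_conjTranspose_mulVec_eigenvector {g : Orb Λ → ℂ} (hg : ∀ i, ‖g i‖ = 1)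
    (hg0 : ∀ x, g (orb x 0) = 1) (hg1 : ∀ x y, G.Adj x y → g (orb x 1) * star (g (orb y 1)) = -1)
    (t U : ℝ) {a b' : ℕ} {φ : Fock (Orb Λ)} (hφ : IsInSector a b' φ) {E : ℂ}
    (hHφ : hamiltonian G t (-U) *ᵥ φ = E • φ) :
    hamiltonian G t U *ᵥ
        ((orbitalPhase g * partialParticleHole (spinDownOrbitals : Finset (Orb Λ)))ᴴ *ᵥ φ) =
      (E + U * a) • ((orbitalPhase g * partialParticleHole (spinDownOrbitals : Finset (Orb Λ)))ᴴ *ᵥ φ) := by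
  set S : Matrix (Finset (Orb Λ)) (Finset (Orb Λ)) ℂ :=
    orbitalPhase g * partialParticleHole (spinDownOrbitals : Finset (Orb Λ)) with hS
  have hSS : Sᴴ * S = 1 := shiba_conjTranspose_mul_self hg
  have hSS' : S * Sᴴ = 1 := shiba_mul_conjTranspose_self hg
  have hconj : S * hamiltonian G t U * Sᴴ = hamiltonian G t (-U) + (U : ℂ) • ∑ x : Λ, numberOp x 0 :=
    shiba_conj_hamiltonian G hg hg0 hg1 t U
  have hrep : hamiltonian G t U = Sᴴ * (hamiltonian G t (-U) + (U : ℂ) • ∑ x : Λ, numberOp x 0) * S := by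
    rw [← hconj]
    simp only [← Matrix.mul_assoc, hSS, Matrix.one_mul]
    rw [Matrix.mul_assoc, hSS, Matrix.mul_one]
  have hNup : (∑ x : Λ, numberOp x 0) *ᵥ φ = (a : ℂ) • φ :=
    Summit.HubbardSuperconductivity.TwTipContinuation.IsogapTransport.sum_numberOp_up_mulVec hφ
  have hφ' : S *ᵥ (Sᴴ *ᵥ φ) = φ := by rw [mulVec_mulVec, hSS', one_mulVec]
  rw [hrep, ← mulVec_mulVec, ← mulVec_mulVec, hφ', add_mulVec, smul_mulVec, hNup, hHφ, smul_smul,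
    ← add_smul, mulVec_smul]

/-- `S χ ≠ 0` for `χ ≠ 0`. [folklore] -/
theorem shiba_mulVec_ne_zero {g : Orb Λ → ℂ} (hg : ∀ i, ‖g i‖ = 1) {χ : Fock (Orb Λ)} (hχ : χ ≠ 0) :
    (orbitalPhase g * partialParticleHole (spinDownOrbitals : Finset (Orb Λ))) *ᵥ χ ≠ 0 := by
  intro h0
  have hSS := shiba_conjTranspose_mul_self (Λ := Λ) hg
  have : χ = (orbitalPhase g * partialParticleHole (spinDownOrbitals : Finset (Orb Λ)))ᴴ *ᵥ
      ((orbitalPhase g * partialParticleHole (spinDownOrbitals : Finset (Orb Λ))) *ᵥ χ) := by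
    rw [mulVec_mulVec, hSS, one_mulVec]
  rw [h0, mulVec_zero] at this
  exact hχ this

/-- `Sᴴ φ ≠ 0` for `φ ≠ 0`. [folklore] -/
theorem shiba_conjTranspose_mulVec_ne_zero {g : Orb Λ → ℂ} (hg : ∀ i, ‖g i‖ = 1) {φ : Fock (Orb Λ)}
    (hφ : φ ≠ 0) :
    (orbitalPhase g * partialParticleHole (spinDownOrbitals : Finset (Orb Λ)))ᴴ *ᵥ φ ≠ 0 := by
  intro h0
  have hSS' := shiba_mul_conjTranspose_self (Λ := Λ) hg
  have : φ = (orbitalPhase g * partialParticleHole (spinDownOrbitals : Finset (Orb Λ))) *ᵥ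
      ((orbitalPhase g * partialParticleHole (spinDownOrbitals : Finset (Orb Λ)))ᴴ *ᵥ φ) := by
    rw [mulVec_mulVec, hSS', one_mulVec]
  rw [h0, mulVec_zero] at this
  exact hφ this

/-- **Sector ground states go to sector ground states under `S`**: a ground state of `H(t,U)` in
the joint sector `(N, S^z) = (a+b, (a-b)/2)` is mapped by `S` to a ground state of `H(t,-U)` in
`(a + (|Λ|-b), (a - (|Λ|-b))/2)` (`a, b ≤ |Λ|`). [cite: Lieb1989, proof of Theorem 2] -/
theorem isGroundStateInSector_shiba {g : Orb Λ → ℂ} (hg : ∀ i, ‖g i‖ = 1) (hg0 : ∀ x, g (orb x 0) = 1)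
    (hg1 : ∀ x y, G.Adj x y → g (orb x 1) * star (g (orb y 1)) = -1) (t U : ℝ) {a b : ℕ}
    (ha : a ≤ Fintype.card Λ) (hb : b ≤ Fintype.card Λ) {χ : Fock (Orb Λ)}
    (hχ : IsGroundStateInSector (hamiltonian G t U) (a + b) (((a : ℝ) - b) / 2) χ) :
    IsGroundStateInSector (hamiltonian G t (-U)) (a + (Fintype.card Λ - b))
      (((a : ℝ) - (Fintype.card Λ - b : ℕ)) / 2)
      ((orbitalPhase g * partialParticleHole (spinDownOrbitals : Finset (Orb Λ))) *ᵥ χ) := by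
  obtain ⟨hmem, hne, hH⟩ := hχ
  have hsec : IsInSector a b χ := (mem_szSector_iff_isInSector a b χ).1 hmem
  refine ⟨(mem_szSector_iff_isInSector _ _ _).2 (isInSector_shiba_mulVec g hsec),
    shiba_mulVec_ne_zero hg hne, ?_⟩
  rw [shiba_mulVec_eigenvector G hg hg0 hg1 t U hsec hH,
    minEnergyOn_szSector_shiba G hg hg0 hg1 t U ha hb]
  push_cast
  ring_nf

/-- **Sector ground states go back under `Sᴴ`**: a ground state of `H(t,-U)` in the joint sector
`(a + (|Λ|-b), (a - (|Λ|-b))/2)` is mapped by `Sᴴ` to a ground state of `H(t,U)` in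
`(a+b, (a-b)/2)` (`a, b ≤ |Λ|`). [cite: Lieb1989, proof of Theorem 2] -/
theorem isGroundStateInSector_shiba_conjTranspose {g : Orb Λ → ℂ} (hg : ∀ i, ‖g i‖ = 1)
    (hg0 : ∀ x, g (orb x 0) = 1) (hg1 : ∀ x y, G.Adj x y → g (orb x 1) * star (g (orb y 1)) = -1)
    (t U : ℝ) {a b : ℕ} (ha : a ≤ Fintype.card Λ) (hb : b ≤ Fintype.card Λ) {φ : Fock (Orb Λ)}
    (hφ : IsGroundStateInSector (hamiltonian G t (-U)) (a + (Fintype.card Λ - b))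
      (((a : ℝ) - (Fintype.card Λ - b : ℕ)) / 2) φ) :
    IsGroundStateInSector (hamiltonian G t U) (a + b) (((a : ℝ) - b) / 2)
      ((orbitalPhase g * partialParticleHole (spinDownOrbitals : Finset (Orb Λ)))ᴴ *ᵥ φ) := by
  obtain ⟨hmem, hne, hH⟩ := hφ
  have hsec : IsInSector a (Fintype.card Λ - b) φ := (mem_szSector_iff_isInSector a _ φ).1 hmem
  refine ⟨(mem_szSector_iff_isInSector _ _ _).2 (isInSector_shiba_conjTranspose_mulVec g hb hsec),
    shiba_conjTranspose_mulVec_ne_zero hg hne, ?_⟩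
  rw [shiba_conjTranspose_mulVec_eigenvector G hg hg0 hg1 t U hsec hH,
    minEnergyOn_szSector_shiba G hg hg0 hg1 t U ha hb]
  push_cast
  ring_nf

/-- **Simplicity of the sector floor is Shiba-invariant**: the ground floor of `H(t,U)` in the
joint sector `(a+b, (a-b)/2)` is one-dimensional iff the ground floor of `H(t,-U)` in
`(a + (|Λ|-b), (a - (|Λ|-b))/2)` is (`a, b ≤ |Λ|`). [cite: Lieb1989, proof of Theorem 2] -/
theorem simpleFloor_shiba_iff {g : Orb Λ → ℂ} (hg : ∀ i, ‖g i‖ = 1) (hg0 : ∀ x, g (orb x 0) = 1)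
    (hg1 : ∀ x y, G.Adj x y → g (orb x 1) * star (g (orb y 1)) = -1) (t U : ℝ) {a b : ℕ}
    (ha : a ≤ Fintype.card Λ) (hb : b ≤ Fintype.card Λ) :
    (∀ φ φ' : Fock (Orb Λ), IsGroundStateInSector (hamiltonian G t U) (a + b) (((a : ℝ) - b) / 2) φ →
        IsGroundStateInSector (hamiltonian G t U) (a + b) (((a : ℝ) - b) / 2) φ' → ∃ c : ℂ, φ' = c • φ) ↔
      (∀ ψ ψ' : Fock (Orb Λ),
        IsGroundStateInSector (hamiltonian G t (-U)) (a + (Fintype.card Λ - b))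
          (((a : ℝ) - (Fintype.card Λ - b : ℕ)) / 2) ψ →
        IsGroundStateInSector (hamiltonian G t (-U)) (a + (Fintype.card Λ - b))
          (((a : ℝ) - (Fintype.card Λ - b : ℕ)) / 2) ψ' → ∃ c : ℂ, ψ' = c • ψ) := by
  set S : Matrix (Finset (Orb Λ)) (Finset (Orb Λ)) ℂ :=
    orbitalPhase g * partialParticleHole (spinDownOrbitals : Finset (Orb Λ)) with hS
  have hSS : Sᴴ * S = 1 := shiba_conjTranspose_mul_self hg
  have hSS' : S * Sᴴ = 1 := shiba_mul_conjTranspose_self hg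
  constructor
  · intro h ψ ψ' hψ hψ'
    obtain ⟨c, hc⟩ := h _ _ (isGroundStateInSector_shiba_conjTranspose G hg hg0 hg1 t U ha hb hψ)
      (isGroundStateInSector_shiba_conjTranspose G hg hg0 hg1 t U ha hb hψ')
    refine ⟨c, ?_⟩
    calc ψ' = S *ᵥ (Sᴴ *ᵥ ψ') := by rw [mulVec_mulVec, hSS', one_mulVec]
      _ = S *ᵥ (c • (Sᴴ *ᵥ ψ)) := by rw [hc]
      _ = c • ψ := by rw [mulVec_smul, mulVec_mulVec, hSS', one_mulVec]
  · intro h φ φ' hφ hφ'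
    obtain ⟨c, hc⟩ := h _ _ (isGroundStateInSector_shiba G hg hg0 hg1 t U ha hb hφ)
      (isGroundStateInSector_shiba G hg hg0 hg1 t U ha hb hφ')
    refine ⟨c, ?_⟩
    calc φ' = Sᴴ *ᵥ (S *ᵥ φ') := by rw [mulVec_mulVec, hSS, one_mulVec]
      _ = Sᴴ *ᵥ (c • (S *ᵥ φ)) := by rw [hc]
      _ = c • φ := by rw [mulVec_smul, mulVec_mulVec, hSS, one_mulVec]

end General

/-! ### The even torus: doped repulsive floor ↔ magnetised attractive half-filled floor -/

section Torus

/-- **The attraction–repulsion dictionary for floor simplicity on the even torus.**  For `L` even,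
any `t, U` and `m ≤ L²`: the ground floor of the repulsive-or-attractive torus `hubbardTorus 2 L t U`
in the sector `(N, S^z) = (2m, 0)` is simple iff the ground floor of `hubbardTorus 2 L t (-U)` in
the HALF-FILLED, MAGNETISED sector `(L², m - L²/2)` is simple (Shiba unitary with the torus stagger
as down-spin gauge). [cite: Lieb1989, proof of Theorem 2] -/
theorem simpleFloor_hubbardTorus_iff_attractive {L : ℕ} (hL : Even L) (t U : ℝ) {m : ℕ}
    (hm : m ≤ L ^ 2) :
    (∀ φ φ' : Fock (Orb (FermionTorus 2 L)), IsGroundStateInSector (hubbardTorus 2 L t U) (2 * m) 0 φ →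
        IsGroundStateInSector (hubbardTorus 2 L t U) (2 * m) 0 φ' → ∃ c : ℂ, φ' = c • φ) ↔
      (∀ ψ ψ' : Fock (Orb (FermionTorus 2 L)),
        IsGroundStateInSector (hubbardTorus 2 L t (-U)) (L ^ 2) ((m : ℝ) - (L : ℝ) ^ 2 / 2) ψ →
        IsGroundStateInSector (hubbardTorus 2 L t (-U)) (L ^ 2) ((m : ℝ) - (L : ℝ) ^ 2 / 2) ψ' →
          ∃ c : ℂ, ψ' = c • ψ) := by
  have hcard : Fintype.card (FermionTorus 2 L) = L ^ 2 := by simp [FermionTorus, Fintype.card_lex]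
  have hm' : m ≤ Fintype.card (FermionTorus 2 L) := by rw [hcard]; exact hm
  have h := simpleFloor_shiba_iff (fermionTorusGraph 2 L)
    (g := fun i : Orb (FermionTorus 2 L) =>
      if (ofLex i).2 = 1 then (((torusStagger (ofLex i).1 : ℤˣ) : ℤ) : ℂ) else (1 : ℂ))
    norm_shibaTorusPhase shibaTorusPhase_up (fun x y hxy => shibaTorusPhase_down_bond hL hxy) t U
    (a := m) (b := m) hm' hm'
  have h1 : (szSector (2 * m) 0 : Submodule ℂ (Fock (Orb (FermionTorus 2 L)))) =
      szSector (m + m) (((m : ℝ) - m) / 2) := szSector_congr (two_mul m) (by simp)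
  have h2 : (szSector (L ^ 2) ((m : ℝ) - (L : ℝ) ^ 2 / 2) : Submodule ℂ (Fock (Orb (FermionTorus 2 L)))) =
      szSector (m + (Fintype.card (FermionTorus 2 L) - m))
        (((m : ℝ) - (Fintype.card (FermionTorus 2 L) - m : ℕ)) / 2) := by
    refine szSector_congr ?_ ?_
    · rw [hcard]; omega
    · rw [hcard, Nat.cast_sub hm]; push_cast; ring
  unfold IsGroundStateInSector at h ⊢
  rw [hubbardTorus, hubbardTorus, h1, h2]
  exact h

/-- **Clause (ii) of `JmCusp` in attractive language.**  For every `U` and every `δ ≥ 0`: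
eventual simplicity (along even `L`) of the ground floor of the repulsive torus
`hubbardTorus 2 L 1 U` in the doped sector `(N_L, S^z = 0)`, `N_L = 2⌊(1-δ)L²/2⌋` — clause (ii) of
the crux verbatim at `(U, δ)` — holds iff the ground floor of the ATTRACTIVE torus
`hubbardTorus 2 L 1 (-U)` at HALF FILLING `N = L²` in the magnetised sector
`S^z = ⌊(1-δ)L²/2⌋ - L²/2` (`≈ -δL²/2`) is eventually simple.  For `U > 0` the right-hand side
is a uniqueness statement for the attractive Hubbard model in a sector with `N↑ ≠ N↓`, outside
the reach of spin-reflection positivity (Lieb 1989, Thm 1: `N↑ = N↓`).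
[cite: Lieb1989, Theorems 1–2] -/
theorem clauseII_iff_attractive_at (U δ : ℝ) (hδ : 0 ≤ δ) :
    (∃ L₀ : ℕ, ∀ (L : ℕ), Even L → L₀ ≤ L → ∀ φ φ' : Fock (Orb (FermionTorus 2 L)),
        IsGroundStateInSector (hubbardTorus 2 L 1 U) (2 * ⌊(1 - δ) * (L : ℝ) ^ 2 / 2⌋₊) 0 φ →
        IsGroundStateInSector (hubbardTorus 2 L 1 U) (2 * ⌊(1 - δ) * (L : ℝ) ^ 2 / 2⌋₊) 0 φ' →
          ∃ c : ℂ, φ' = c • φ) ↔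
      (∃ L₀ : ℕ, ∀ (L : ℕ), Even L → L₀ ≤ L → ∀ ψ ψ' : Fock (Orb (FermionTorus 2 L)),
        IsGroundStateInSector (hubbardTorus 2 L 1 (-U)) (L ^ 2)
          ((⌊(1 - δ) * (L : ℝ) ^ 2 / 2⌋₊ : ℝ) - (L : ℝ) ^ 2 / 2) ψ →
        IsGroundStateInSector (hubbardTorus 2 L 1 (-U)) (L ^ 2)
          ((⌊(1 - δ) * (L : ℝ) ^ 2 / 2⌋₊ : ℝ) - (L : ℝ) ^ 2 / 2) ψ' →
          ∃ c : ℂ, ψ' = c • ψ) := by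
  -- the doped filling fits on the torus: `⌊(1-δ)L²/2⌋ ≤ L²` (cf. `floor_filling_le` of the
  -- IncommensurateRigidity birth line, not imported here)
  have hfl : ∀ L : ℕ, ⌊(1 - δ) * (L : ℝ) ^ 2 / 2⌋₊ ≤ L ^ 2 := fun L =>
    Nat.floor_le_of_le (by push_cast; nlinarith [sq_nonneg (L : ℝ)])
  constructor
  · rintro ⟨L₀, h⟩
    exact ⟨L₀, fun L hE hL => (simpleFloor_hubbardTorus_iff_attractive hE 1 U (hfl L)).1 (h L hE hL)⟩
  · rintro ⟨L₀, h⟩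
    exact ⟨L₀, fun L hE hL => (simpleFloor_hubbardTorus_iff_attractive hE 1 U (hfl L)).2 (h L hE hL)⟩

/-- **Registered sub-goal form** (binder-free restatement of `clauseII_iff_attractive_at`, the
signature registered on stmt-HubbardSuperconductivity-2228): clause (ii) of `JmCusp` at `(U, δ)`,
`δ ≥ 0`, is equivalent to eventual simplicity of the half-filled attractive torus floor in the
magnetised sector `S^z = ⌊(1-δ)L²/2⌋ - L²/2`. [cite: Lieb1989, Theorems 1–2] -/
theorem jmCusp_clauseII_iff_attractive : ∀ (U δ : ℝ), 0 ≤ δ → ((∃ L₀ : ℕ, ∀ (L : ℕ), Even L → L₀ ≤ L → ∀ φ φ' : Literature.MathematicalPhysics.QuantumLattice.Fock (Literature.MathematicalPhysics.QuantumLattice.Orb (Literature.MathematicalPhysics.QuantumLattice.FermionTorus 2 L)), Literature.MathematicalPhysics.QuantumLattice.IsGroundStateInSector (Literature.MathematicalPhysics.QuantumLattice.hubbardTorus 2 L 1 U) (2 * ⌊(1 - δ) * (L : ℝ) ^ 2 / 2⌋₊) 0 φ → Literature.MathematicalPhysics.QuantumLattice.IsGroundStateInSector (Literature.MathematicalPhysics.QuantumLattice.hubbardTorus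 2 L 1 U) (2 * ⌊(1 - δ) * (L : ℝ) ^ 2 / 2⌋₊) 0 φ' → ∃ c : ℂ, φ' = c • φ) ↔ (∃ L₀ : ℕ, ∀ (L : ℕ), Even L → L₀ ≤ L → ∀ ψ ψ' : Literature.MathematicalPhysics.QuantumLattice.Fock (Literature.MathematicalPhysics.QuantumLattice.Orb (Literature.MathematicalPhysics.QuantumLattice.FermionTorus 2 L)), Literature.MathematicalPhysics.QuantumLattice.IsGroundStateInSector (Literature.MathematicalPhysics.QuantumLattice.hubbardTorus 2 L 1 (-U)) (L ^ 2) ((⌊(1 - δ) * (L : ℝ) ^ 2 / 2⌋₊ : ℝ) - (L : ℝ) ^ 2 / 2) ψ → Literature.MathematicalPhysics.QuantumLattice.IsGroundStateInSector (Literature.MathematicalPhysics.QuantumLattice.hubbardTorus 2 L 1 (-U)) (L ^ 2) ((⌊(1 - δ) * (L : ℝ) ^ 2 / 2⌋₊ : ℝ) - (L : ℝ) ^ 2 / 2) ψ' → ∃ c : ℂ, ψ' = c • ψ)) :=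
  fun U δ hδ => clauseII_iff_attractive_at U δ hδ

end Torus

end Summit.HubbardSuperconductivity.HubbardSuperconductivity.Theorems.JosephsonMirror

end
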